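import Mathlib
import HarnessLib

/-!
# Discriminants of the rank-two lattices `⟨h², a[Π₁] + b[Π₂]⟩` on a cubic fourfold containing two planes

B. Hassett, *Special cubic fourfolds*, Compositio Math. 120 (2000) 1–23 [cite: Hassett2000, §3–§4]:
a smooth cubic fourfold `X ⊂ ℙ⁵` is *special of discriminant `d`* when its algebraic lattice
`A(X) = H^{2,2}(X) ∩ H⁴(X,ℤ)` contains a primitive rank-two sublattice `K ∋ h²` of discriminant `d`;
"Special cubic fourfolds of discriminant `d` form a nonempty irreducible divisor `𝒞_d ⊂ 𝒞` if and only if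
`d > 6` and `d ≡ 0, 2 mod 6`" (quoted from Auel–Bernardara, arXiv:1612.02415, Thm. 4.3.8 = Hassett's
Thm. 1.0.1; this existence/irreducibility theorem is NOT vendored here — only arithmetic is).
Intersection numbers used (all printed): for a plane `P ⊂ X`, `h⁴ = 3`, `h²·P = 1`, `P² = 3`, so
`⟨h², P⟩` has discriminant `8` [cite: Hassett2000, §4.1.1]; S. Yang, X. Yu, *On lattice polarizable cubic
fourfolds*, arXiv:2103.09132, §6.1: "(2) Let `X` be a cubic fourfold containing a plane `P`. Then there is
a primitive sublattice `⟨h², [P]⟩ ⊂ A(X)` of discriminant `8` … Let `X` be a cubic fourfold containing two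
disjoint planes `P` and `P'`. Then … the primitive sublattice `⟨h², h² − [P] − [P']⟩ ⊂ A(X)` is of
discriminant `14`" [cite: YangYu2021, §6.1]. Two planes meeting transversally in one point have
intersection number `1`; disjoint planes have intersection number `0`.

What this file PROVES (arithmetic only; no geometry is formalised and no fact is introduced):
* the Gram matrix of `⟨h², aΠ₁ + bΠ₂⟩` for two planes with `Π₁·Π₂ = i` and its determinant
  `8a² + (6i − 2)ab + 8b²` (`pencilGram_det`); the two cases used by the Hodge-locus census of cubic
  `2k`-folds containing two `k`-planes (Kloosterman, arXiv:2312.12363, Thm. 5.3: the tangent-hyperplane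
  section at an Eckardt point of a split cubic is a cone over a cubic fourfold `Σ` containing two planes
  [cite: Kloosterman2025, Thm. 5.3]; Movasati, arXiv:2211.11405, Conj. 1 [cite: Movasati2022HodgeLocus, Conj. 1]):
  disjoint planes `disc = 8a² − 2ab + 8b²`, planes meeting in a point `disc = 8a² + 4ab + 8b²`;
* the dictionary values: `(a,b) = (1,1) ↦ 14` (the `𝒞₁₄`/Pfaffian/quintic-del-Pezzo class, matching the
  printed "two disjoint planes ⇒ discriminant 14"), `(1,−1) ↦ 18`, `(1,±2) ↦ 36, 44`, `(1,±3) ↦ 74, 86`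
  (disjoint); `(1,−1) ↦ 12` (the cubic-scroll class `h² + Π₁ − Π₂`, `𝒞₁₂`), `(1,1) ↦ 20` (the Veronese
  class `2h² − Π₁ − Π₂`, `𝒞₂₀`), `(1,2) ↦ 48` (point case);
* Hassett's numerical condition holds for every pencil member: both discriminants are `≡ 0` or `2 (mod 6)`
  for all integers `a, b`, and are `≥ 14` resp. `≥ 12 > 6` as soon as `ab ≠ 0`;
* the parameter count behind "cubic `n`-folds with an Eckardt point ↔ pairs (cubic `(n−1)`-fold,
  hyperplane)" (Laza–Pearlstein–Zhang, Adv. Math. 340 (2018), Def. 9 / Lemma 10: normal form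
  `g(y₀,…,y_n) + y₀y_{n+1}²` [cite: LazaPearlsteinZhang2017, Lemma 10]): the codimension of the Eckardt
  locus in the moduli of cubic `n`-folds is `C(n,2)` (`eckardtLocus_codim`; `n = 4` gives the printed `6`,
  `n = 6` gives `15`, so the locus has dimension `56 − 15 = 41` for cubic sixfolds).
* (appended 2026-08-19, lit-g8) the THIRD configuration, planes meeting along a line: Degtyarev–Itenberg–Ottem,
  *Planes in cubic fourfolds*, Algebr. Geom. 10 (2023) §2.4 [cite: DegtyarevItenbergOttem2023, §2.4]: "using the
  normal bundle sequence, we find that `p² = c₂(N_{P|X}) = 3`. Furthermore, given two distinct planes `P₁`, `P₂`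
  with classes `p₁`, `p₂`, one has the following trichotomy: `p₁·p₂ = 0` if `P₁` and `P₂` are disjoint;
  `p₁·p₂ = 1` if `P₁` and `P₂` intersect at a point; `p₁·p₂ = −1` if `P₁` and `P₂` intersect in a line"
  (also Huybrechts, *The geometry of cubic hypersurfaces*, Ch. 6 Lemma 1.1 for `([P].[P]) = 3`
  [cite: Huybrechts2023Cubic, Ch. 6 Lemma 1.1]): `disc ⟨h², aΠ₁ + bΠ₂⟩ = 8(a² − ab + b²)` (`disc_line`), the
  residual plane `Π₃ = h² − Π₁ − Π₂` of the `ℙ³ = ⟨Π₁, Π₂⟩` is consistent with the trichotomy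
  (`residualPlane_*`), dictionary `(1,0), (1,1) ↦ 8`, `(1,−1), (1,2), (2,1) ↦ 24`, `(1,−2), (1,3) ↦ 56`,
  Hassett's condition (`≡ 0, 2 mod 6`, `≥ 8 > 6` off the origin).
HONEST FRAMING (cell pub-hlocus): certified instances and evidence bearing on the general Hodge
conjecture; no claim.
-/

namespace Literature.AlgebraicGeometry.Hassett2000

open Matrix

/-- Gram matrix of `⟨h², P⟩` for a plane `P` in a smooth cubic fourfold: `h⁴ = 3`, `h²·P = 1`, `P² = 3`.
[cite: Hassett2000, §4.1.1] -/
def planeGram : Matrix (Fin 2) (Fin 2) ℤ := !![3, 1; 1, 3]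

/-- `⟨h², P⟩` has discriminant `8` (`𝒞₈`). [cite: Hassett2000, §4.1.1; YangYu2021, §6.1] -/
theorem planeGram_det : planeGram.det = 8 := by
  simp [planeGram, Matrix.det_fin_two]

/-- Gram matrix of `⟨h², Π₁, Π₂⟩` for two planes in a smooth cubic fourfold with `Π₁·Π₂ = i`
(`i = 0`: disjoint planes; `i = 1`: planes meeting transversally in one point).
[cite: Hassett2000, §4.1.1] for the diagonal and `h²`-entries. -/
def twoPlanesGram (i : ℤ) : Matrix (Fin 3) (Fin 3) ℤ := !![3, 1, 1; 1, 3, i; 1, i, 3]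

/-- Gram matrix of the rank-two lattice `⟨h², aΠ₁ + bΠ₂⟩` inside `⟨h², Π₁, Π₂⟩` with `Π₁·Π₂ = i`:
`h²·(aΠ₁+bΠ₂) = a + b`, `(aΠ₁+bΠ₂)² = 3a² + 2iab + 3b²`. [cite: Hassett2000, §4.1.1] -/
def pencilGram (i a b : ℤ) : Matrix (Fin 2) (Fin 2) ℤ :=
  !![3, a + b; a + b, 3 * a ^ 2 + 2 * i * a * b + 3 * b ^ 2]

/-- The entries of `pencilGram` are the values of the bilinear form of `twoPlanesGram` on the vectors
`h² = (1,0,0)` and `aΠ₁ + bΠ₂ = (0,a,b)`. [folklore] -/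
theorem pencilGram_eq_bilinear (i a b : ℤ) :
    pencilGram i a b =
      !![![1, 0, 0] ⬝ᵥ (twoPlanesGram i).mulVec ![1, 0, 0], ![1, 0, 0] ⬝ᵥ (twoPlanesGram i).mulVec ![0, a, b];
        ![0, a, b] ⬝ᵥ (twoPlanesGram i).mulVec ![1, 0, 0], ![0, a, b] ⬝ᵥ (twoPlanesGram i).mulVec ![0, a, b]] := by
  ext j k
  fin_cases j <;> fin_cases k <;>
    simp [pencilGram, twoPlanesGram, Matrix.mulVec, dotProduct, Fin.sum_univ_three]
  ring

/-- Discriminant of `⟨h², aΠ₁ + bΠ₂⟩`: `8a² + (6i − 2)ab + 8b²`. [cite: Hassett2000, §4.1] -/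
theorem pencilGram_det (i a b : ℤ) :
    (pencilGram i a b).det = 8 * a ^ 2 + (6 * i - 2) * a * b + 8 * b ^ 2 := by
  simp [pencilGram, Matrix.det_fin_two]
  ring

/-- Disjoint planes (`Π₁·Π₂ = 0`): `disc ⟨h², aΠ₁ + bΠ₂⟩ = 8a² − 2ab + 8b²`. [cite: Hassett2000, §4.1] -/
theorem disc_disjoint (a b : ℤ) : (pencilGram 0 a b).det = 8 * a ^ 2 - 2 * a * b + 8 * b ^ 2 := by
  rw [pencilGram_det]; ring

/-- Planes meeting in a point (`Π₁·Π₂ = 1`): `disc ⟨h², aΠ₁ + bΠ₂⟩ = 8a² + 4ab + 8b²`. [cite: Hassett2000, §4.1] -/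
theorem disc_point (a b : ℤ) : (pencilGram 1 a b).det = 8 * a ^ 2 + 4 * a * b + 8 * b ^ 2 := by
  rw [pencilGram_det]; ring

/-! ### The dictionary values used by the census (disjoint planes: cubic `2k`-folds with two `k`-planes
meeting in dimension `k − 3`; point case: meeting in dimension `k − 2`). -/

/-- `Π₁ + Π₂`, disjoint: discriminant `14` — the class `h² − Π₁ − Π₂` spans the same lattice with `h²`;
"two disjoint planes ⇒ `⟨h², h² − [P] − [P']⟩` of discriminant 14" [cite: YangYu2021, §6.1]. -/
theorem disc_disjoint_one_one : (pencilGram 0 1 1).det = 14 := by rw [disc_disjoint]; norm_num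

/-- `det !![3,1;1,5] = 14`: discriminant of `⟨h², h² − P − P'⟩`. [cite: YangYu2021, §6.1] -/
theorem disc_disjoint_hsq_sub : (!![3, 1; 1, 5] : Matrix (Fin 2) (Fin 2) ℤ).det = 14 := by
  simp [Matrix.det_fin_two]

/-- The Gram matrix of `⟨h², h² − Π₁ − Π₂⟩` (disjoint planes) is `!![3,1;1,5]`:
`h²·(h²−Π₁−Π₂) = 3 − 1 − 1`, `(h²−Π₁−Π₂)² = 3 − 2 − 2 + 3 + 3 + 0`. [cite: YangYu2021, §6.1] -/
theorem gram_hsq_sub_disjoint :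
    (![1, -1, -1] ⬝ᵥ (twoPlanesGram 0).mulVec ![1, 0, 0], ![1, -1, -1] ⬝ᵥ (twoPlanesGram 0).mulVec ![1, -1, -1])
      = ((1 : ℤ), (5 : ℤ)) := by
  simp [twoPlanesGram, Matrix.mulVec, dotProduct, Fin.sum_univ_three]

/-- `Π₁ − Π₂`, disjoint planes: discriminant `18` (arithmetic from `disc_disjoint`). [cite: Hassett2000, §4.1] -/
theorem disc_disjoint_one_neg_one : (pencilGram 0 1 (-1)).det = 18 := by rw [disc_disjoint]; norm_num
/-- `Π₁ + 2Π₂`, disjoint planes: discriminant `36`. [cite: Hassett2000, §4.1] -/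
theorem disc_disjoint_one_two : (pencilGram 0 1 2).det = 36 := by rw [disc_disjoint]; norm_num
/-- `2Π₁ + Π₂`, disjoint planes: discriminant `36`. [cite: Hassett2000, §4.1] -/
theorem disc_disjoint_two_one : (pencilGram 0 2 1).det = 36 := by rw [disc_disjoint]; norm_num
/-- `Π₁ − 2Π₂`, disjoint planes: discriminant `44`. [cite: Hassett2000, §4.1] -/
theorem disc_disjoint_one_neg_two : (pencilGram 0 1 (-2)).det = 44 := by rw [disc_disjoint]; norm_num
/-- `Π₁ + 3Π₂`, disjoint planes: discriminant `74`. [cite: Hassett2000, §4.1] -/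
theorem disc_disjoint_one_three : (pencilGram 0 1 3).det = 74 := by rw [disc_disjoint]; norm_num
/-- `Π₁ − 3Π₂`, disjoint planes: discriminant `86`. [cite: Hassett2000, §4.1] -/
theorem disc_disjoint_one_neg_three : (pencilGram 0 1 (-3)).det = 86 := by rw [disc_disjoint]; norm_num
/-- `2Π₁ + 3Π₂`, disjoint planes: discriminant `92`. [cite: Hassett2000, §4.1] -/
theorem disc_disjoint_two_three : (pencilGram 0 2 3).det = 92 := by rw [disc_disjoint]; norm_num

/-- `Π₁ − Π₂`, planes meeting in a point: discriminant `12` (`𝒞₁₂`, cubic scrolls). [cite: Hassett2000, §4.1.2] -/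
theorem disc_point_one_neg_one : (pencilGram 1 1 (-1)).det = 12 := by rw [disc_point]; norm_num

/-- The cubic-scroll class `T = h² + Π₁ − Π₂` (planes meeting in a point) has `h²·T = 3` and `T² = 7`,
the printed invariants of a rational normal cubic scroll in a cubic fourfold [cite: Hassett2000, §4.1.2]. -/
theorem gram_cubicScrollClass :
    (![1, 1, -1] ⬝ᵥ (twoPlanesGram 1).mulVec ![1, 0, 0], ![1, 1, -1] ⬝ᵥ (twoPlanesGram 1).mulVec ![1, 1, -1])
      = ((3 : ℤ), (7 : ℤ)) := by
  simp [twoPlanesGram, Matrix.mulVec, dotProduct, Fin.sum_univ_three]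

/-- `det !![3,3;3,7] = 12`: the cubic-scroll lattice `𝒞₁₂`. [cite: Hassett2000, §4.1.2] -/
theorem disc_cubicScrollClass : (!![3, 3; 3, 7] : Matrix (Fin 2) (Fin 2) ℤ).det = 12 := by
  simp [Matrix.det_fin_two]

/-- `Π₁ + Π₂`, planes meeting in a point: discriminant `20` (`𝒞₂₀`); the class `V = 2h² − Π₁ − Π₂` has
`h²·V = 4`, `V² = 12`, the printed invariants of a Veronese surface [cite: Hassett2000, §4.1.3]. -/
theorem disc_point_one_one : (pencilGram 1 1 1).det = 20 := by rw [disc_point]; norm_num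

/-- `V = 2h² − Π₁ − Π₂` (planes meeting in a point): `h²·V = 4`, `V² = 12`. [cite: Hassett2000, §4.1.3] -/
theorem gram_veroneseClass :
    (![2, -1, -1] ⬝ᵥ (twoPlanesGram 1).mulVec ![1, 0, 0], ![2, -1, -1] ⬝ᵥ (twoPlanesGram 1).mulVec ![2, -1, -1])
      = ((4 : ℤ), (12 : ℤ)) := by
  simp [twoPlanesGram, Matrix.mulVec, dotProduct, Fin.sum_univ_three]

/-- `det !![3,4;4,12] = 20`: the Veronese lattice `𝒞₂₀`. [cite: Hassett2000, §4.1.3] -/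
theorem disc_veroneseClass : (!![3, 4; 4, 12] : Matrix (Fin 2) (Fin 2) ℤ).det = 20 := by
  simp [Matrix.det_fin_two]

/-- `Π₁ + 2Π₂`, planes meeting in a point: discriminant `48`. [cite: Hassett2000, §4.1] -/
theorem disc_point_one_two : (pencilGram 1 1 2).det = 48 := by rw [disc_point]; norm_num

/-! ### Hassett's numerical condition `d > 6`, `d ≡ 0, 2 (mod 6)` holds for every pencil member. -/

/-- `8a² − 2ab + 8b² ≡ 0` or `2 (mod 6)` for all integers `a, b` (elementary). [folklore] -/
theorem disc_disjoint_mod_six (a b : ℤ) :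
    (8 * a ^ 2 - 2 * a * b + 8 * b ^ 2) % 6 = 0 ∨ (8 * a ^ 2 - 2 * a * b + 8 * b ^ 2) % 6 = 2 := by
  have key : ∀ x y : ZMod 6, 8 * x ^ 2 - 2 * x * y + 8 * y ^ 2 = 0 ∨ 8 * x ^ 2 - 2 * x * y + 8 * y ^ 2 = 2 := by
    decide
  rcases key (a : ZMod 6) (b : ZMod 6) with h | h
  · left
    have h' : (((8 * a ^ 2 - 2 * a * b + 8 * b ^ 2 : ℤ)) : ZMod 6) = ((0 : ℤ) : ZMod 6) := by
      push_cast; exact h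
    rw [ZMod.intCast_eq_intCast_iff'] at h'
    simpa using h'
  · right
    have h' : (((8 * a ^ 2 - 2 * a * b + 8 * b ^ 2 : ℤ)) : ZMod 6) = ((2 : ℤ) : ZMod 6) := by
      push_cast; exact h
    rw [ZMod.intCast_eq_intCast_iff'] at h'
    simpa using h'

/-- `8a² + 4ab + 8b² ≡ 0` or `2 (mod 6)` for all integers `a, b` (elementary). [folklore] -/
theorem disc_point_mod_six (a b : ℤ) :
    (8 * a ^ 2 + 4 * a * b + 8 * b ^ 2) % 6 = 0 ∨ (8 * a ^ 2 + 4 * a * b + 8 * b ^ 2) % 6 = 2 := by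
  have key : ∀ x y : ZMod 6, 8 * x ^ 2 + 4 * x * y + 8 * y ^ 2 = 0 ∨ 8 * x ^ 2 + 4 * x * y + 8 * y ^ 2 = 2 := by
    decide
  rcases key (a : ZMod 6) (b : ZMod 6) with h | h
  · left
    have h' : (((8 * a ^ 2 + 4 * a * b + 8 * b ^ 2 : ℤ)) : ZMod 6) = ((0 : ℤ) : ZMod 6) := by
      push_cast; exact h
    rw [ZMod.intCast_eq_intCast_iff'] at h'
    simpa using h'
  · right
    have h' : (((8 * a ^ 2 + 4 * a * b + 8 * b ^ 2 : ℤ)) : ZMod 6) = ((2 : ℤ) : ZMod 6) := by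
      push_cast; exact h
    rw [ZMod.intCast_eq_intCast_iff'] at h'
    simpa using h'

/-- For `ab ≠ 0` the disjoint-pair discriminant is at least `14` (in particular `> 6`):
`8a² − 2ab + 8b² = 7a² + 7b² + (a − b)²` (elementary). [folklore] -/
theorem fourteen_le_disc_disjoint {a b : ℤ} (ha : a ≠ 0) (hb : b ≠ 0) :
    14 ≤ 8 * a ^ 2 - 2 * a * b + 8 * b ^ 2 := by
  have ha2 : 1 ≤ a ^ 2 := by
    rcases Int.ne_iff_lt_or_gt.mp ha with h | h <;> nlinarith
  have hb2 : 1 ≤ b ^ 2 := by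
    rcases Int.ne_iff_lt_or_gt.mp hb with h | h <;> nlinarith
  nlinarith [sq_nonneg (a - b)]

/-- For `ab ≠ 0` the point-pair discriminant is at least `12` (in particular `> 6`):
`8a² + 4ab + 8b² = 6a² + 6b² + 2(a + b)²` (elementary). [folklore] -/
theorem twelve_le_disc_point {a b : ℤ} (ha : a ≠ 0) (hb : b ≠ 0) :
    12 ≤ 8 * a ^ 2 + 4 * a * b + 8 * b ^ 2 := by
  have ha2 : 1 ≤ a ^ 2 := by
    rcases Int.ne_iff_lt_or_gt.mp ha with h | h <;> nlinarith
  have hb2 : 1 ≤ b ^ 2 := by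
    rcases Int.ne_iff_lt_or_gt.mp hb with h | h <;> nlinarith
  nlinarith [sq_nonneg (a + b)]

/-- Hassett's numerical condition "`d > 6` and `d ≡ 0, 2 (mod 6)`" [cite: Hassett2000, Thm. 1.0.1] is met
by `disc ⟨h², aΠ₁ + bΠ₂⟩` for every `a, b` with `ab ≠ 0`, in both configurations. -/
theorem hassettCondition_disc_disjoint {a b : ℤ} (ha : a ≠ 0) (hb : b ≠ 0) :
    6 < (pencilGram 0 a b).det ∧ ((pencilGram 0 a b).det % 6 = 0 ∨ (pencilGram 0 a b).det % 6 = 2) := by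
  rw [disc_disjoint]
  exact ⟨by linarith [fourteen_le_disc_disjoint ha hb], disc_disjoint_mod_six a b⟩

/-- Point case of the previous statement. [cite: Hassett2000, Thm. 1.0.1] -/
theorem hassettCondition_disc_point {a b : ℤ} (ha : a ≠ 0) (hb : b ≠ 0) :
    6 < (pencilGram 1 a b).det ∧ ((pencilGram 1 a b).det % 6 = 0 ∨ (pencilGram 1 a b).det % 6 = 2) := by
  rw [disc_point]
  exact ⟨by linarith [twelve_le_disc_point ha hb], disc_point_mod_six a b⟩

/-! ### The Eckardt-point parameter count (Laza–Pearlstein–Zhang normal form). -/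

/-- Dimension of the (projective) parameter space of cubic `n`-folds modulo `PGL(n+2)`:
`C(n+4, 3) − (n+2)²` (number of cubic monomials in `n+2` variables minus `dim GL(n+2)`). [folklore] -/
def cubicModuliDim (n : ℕ) : ℤ := ((n + 4).choose 3 : ℤ) - (n + 2) ^ 2

/-- Cubic fourfolds: `56 − 36 = 20` moduli. [folklore] -/
theorem cubicModuliDim_four : cubicModuliDim 4 = 20 := by decide
/-- Cubic fivefolds: `84 − 49 = 35` moduli. [folklore] -/
theorem cubicModuliDim_five : cubicModuliDim 5 = 35 := by decide
/-- Cubic sixfolds: `120 − 64 = 56` moduli. [folklore] -/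
theorem cubicModuliDim_six : cubicModuliDim 6 = 56 := by decide

/-- Codimension of the locus of cubic `n`-folds with an Eckardt point: by the normal form
`g(y₀,…,y_n) + y₀y_{n+1}²` such cubics correspond to pairs (cubic `(n−1)`-fold, hyperplane in `ℙⁿ`)
[cite: LazaPearlsteinZhang2017, Lemma 10], a family of dimension `cubicModuliDim (n−1) + n`; the
difference is `C(n, 2)` for every `n ≥ 1` (stated with `n + 1` in place of `n`). -/
theorem eckardtLocus_codim (n : ℕ) :
    cubicModuliDim (n + 1) - (cubicModuliDim n + (n + 1 : ℕ)) = ((n + 1).choose 2 : ℤ) := by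
  have h1 : (n + 5).choose 3 = (n + 4).choose 2 + (n + 4).choose 3 := Nat.choose_succ_succ' (n + 4) 2
  have h2 : (n + 4).choose 2 = (n + 3).choose 1 + (n + 3).choose 2 := Nat.choose_succ_succ' (n + 3) 1
  have h3 : (n + 3).choose 2 = (n + 2).choose 1 + (n + 2).choose 2 := Nat.choose_succ_succ' (n + 2) 1
  have h4 : (n + 2).choose 2 = (n + 1).choose 1 + (n + 1).choose 2 := Nat.choose_succ_succ' (n + 1) 1
  simp only [Nat.choose_one_right] at h2 h3 h4
  unfold cubicModuliDim
  have e5 : n + 1 + 4 = n + 5 := by ring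
  rw [e5, h1, h2, h3, h4]
  push_cast
  ring

/-- `n = 4`: cubic fourfolds with an Eckardt point have codimension `6` (`20 − (10 + 4)`), the printed
count behind [cite: LazaPearlsteinZhang2017, §1]. -/
theorem eckardtLocus_codim_four : cubicModuliDim 4 - (cubicModuliDim 3 + 4) = 6 := by decide

/-- `n = 6`: cubic sixfolds with an Eckardt point have codimension `15 = C(6,2)`, i.e. form a
`41`-dimensional family; with one Noether–Lefschetz condition on the conical section (a cubic fourfold,
`h^{3,1} = 1`) the cone locus has dimension `40`. [cite: LazaPearlsteinZhang2017, Lemma 10] -/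
theorem eckardtLocus_codim_six : cubicModuliDim 6 - (cubicModuliDim 5 + 6) = 15 := by decide

/-- `56 − 15 = 41` and `41 − 1 = 40`. [folklore] -/
theorem eckardtLocus_dim_six : cubicModuliDim 6 - 15 = 41 ∧ cubicModuliDim 6 - 15 - 1 = 40 := by decide

/-! ### Planes meeting along a line (`Π₁·Π₂ = −1`): the third case of the printed trichotomy
"`p₁·p₂ = 0` if `P₁` and `P₂` are disjoint; `p₁·p₂ = 1` if `P₁` and `P₂` intersect at a point; `p₁·p₂ = −1`
if `P₁` and `P₂` intersect in a line" (Degtyarev–Itenberg–Ottem, Algebr. Geom. 10 (2023), §2.4). -/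

/-- Planes meeting along a line (`Π₁·Π₂ = −1`): `disc ⟨h², aΠ₁ + bΠ₂⟩ = 8a² − 8ab + 8b²`.
[cite: DegtyarevItenbergOttem2023, §2.4] [cite: Hassett2000, §4.1] -/
theorem disc_line (a b : ℤ) : (pencilGram (-1) a b).det = 8 * a ^ 2 - 8 * a * b + 8 * b ^ 2 := by
  rw [pencilGram_det]; ring

/-- … i.e. `8·(a² − ab + b²)`, eight times the norm form of `ℤ[ζ₃]`. [cite: DegtyarevItenbergOttem2023, §2.4] -/
theorem disc_line_eq (a b : ℤ) : (pencilGram (-1) a b).det = 8 * (a ^ 2 - a * b + b ^ 2) := by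
  rw [disc_line]; ring

/-- Consistency of the trichotomy with the residual plane: two planes meeting along a line span a `ℙ³`
whose section `X ∩ ℙ³` is a cubic surface containing `Π₁ ∪ Π₂`, so `h² = Π₁ + Π₂ + Π₃` with a third plane
`Π₃`; in the lattice `⟨h², Π₁, Π₂⟩` with `Π₁·Π₂ = −1` the vector `Π₃ := h² − Π₁ − Π₂ = (1,−1,−1)` indeed
has `Π₃² = 3`, `h²·Π₃ = 1` and `Π₃·Π₁ = Π₃·Π₂ = −1` (it meets each of `Π₁, Π₂` along a line).
[cite: DegtyarevItenbergOttem2023, §2.4] [cite: Huybrechts2023Cubic, Ch. 6 Lemma 1.1] -/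
theorem residualPlane_line :
    ![1, -1, -1] ⬝ᵥ (twoPlanesGram (-1)).mulVec ![1, -1, -1] = 3 ∧
    ![1, 0, 0] ⬝ᵥ (twoPlanesGram (-1)).mulVec ![1, -1, -1] = 1 ∧
    ![0, 1, 0] ⬝ᵥ (twoPlanesGram (-1)).mulVec ![1, -1, -1] = -1 ∧
    ![0, 0, 1] ⬝ᵥ (twoPlanesGram (-1)).mulVec ![1, -1, -1] = -1 := by
  simp [twoPlanesGram, Matrix.mulVec, dotProduct, Fin.sum_univ_three]

/-- By contrast, for DISJOINT planes or planes meeting in a POINT the class `h² − Π₁ − Π₂` has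
self-intersection `5` resp. `7` (not `3`), so it is not the class of a plane (`p² = 3`): the residual-plane
relation `h² = Π₁ + Π₂ + Π₃` is specific to the line case. [cite: DegtyarevItenbergOttem2023, §2.4] -/
theorem residualClass_sq_disjoint_point :
    ![1, -1, -1] ⬝ᵥ (twoPlanesGram 0).mulVec ![1, -1, -1] = 5 ∧
    ![1, -1, -1] ⬝ᵥ (twoPlanesGram 1).mulVec ![1, -1, -1] = 7 := by
  simp [twoPlanesGram, Matrix.mulVec, dotProduct, Fin.sum_univ_three]

/-- Line case, `(a,b) = (1,0)` and `(1,1)`: discriminant `8` both times — `Π₁ + Π₂ = h² − Π₃` spans with `h²`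
the lattice `⟨h², Π₃⟩ ≅ K₈` of a single plane. [cite: DegtyarevItenbergOttem2023, §2.4] [cite: Hassett2000, §4.1.1] -/
theorem disc_line_one_zero_one_one : (pencilGram (-1) 1 0).det = 8 ∧ (pencilGram (-1) 1 1).det = 8 := by
  constructor <;> (rw [disc_line]; norm_num)

/-- Line case, `(a,b) = (1,−1)`, `(1,2)`, `(2,1)`: discriminant `24` (`𝒞₂₄`) each.
[cite: DegtyarevItenbergOttem2023, §2.4] [cite: Hassett2000, §4.1] -/
theorem disc_line_twentyfour :
    (pencilGram (-1) 1 (-1)).det = 24 ∧ (pencilGram (-1) 1 2).det = 24 ∧ (pencilGram (-1) 2 1).det = 24 := by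
  refine ⟨?_, ?_, ?_⟩ <;> (rw [disc_line]; norm_num)

/-- Line case, `(a,b) = (1,−2)`, `(1,3)`, `(3,2)`: discriminant `56` each (norm `7`).
[cite: DegtyarevItenbergOttem2023, §2.4] [cite: Hassett2000, §4.1] -/
theorem disc_line_fiftysix :
    (pencilGram (-1) 1 (-2)).det = 56 ∧ (pencilGram (-1) 1 3).det = 56 ∧ (pencilGram (-1) 3 2).det = 56 := by
  refine ⟨?_, ?_, ?_⟩ <;> (rw [disc_line]; norm_num)

/-- `8a² − 8ab + 8b² ≡ 0` or `2 (mod 6)` for all integers `a, b` (the norm `a² − ab + b²` is `0` or `1 mod 3`).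
[cite: Hassett2000, Thm. 1.0.1] -/
theorem disc_line_mod_six (a b : ℤ) :
    (8 * a ^ 2 - 8 * a * b + 8 * b ^ 2) % 6 = 0 ∨ (8 * a ^ 2 - 8 * a * b + 8 * b ^ 2) % 6 = 2 := by
  have key : ∀ x y : ZMod 6, 8 * x ^ 2 - 8 * x * y + 8 * y ^ 2 = 0 ∨ 8 * x ^ 2 - 8 * x * y + 8 * y ^ 2 = 2 := by
    decide
  rcases key (a : ZMod 6) (b : ZMod 6) with h | h
  · left
    have h' : (((8 * a ^ 2 - 8 * a * b + 8 * b ^ 2 : ℤ)) : ZMod 6) = ((0 : ℤ) : ZMod 6) := by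
      push_cast; exact h
    rw [ZMod.intCast_eq_intCast_iff'] at h'
    simpa using h'
  · right
    have h' : (((8 * a ^ 2 - 8 * a * b + 8 * b ^ 2 : ℤ)) : ZMod 6) = ((2 : ℤ) : ZMod 6) := by
      push_cast; exact h
    rw [ZMod.intCast_eq_intCast_iff'] at h'
    simpa using h'

/-- Off the origin the line-pair discriminant is at least `8` (so `> 6`): `a² − ab + b²` is a positive
definite integral form (`4(a² − ab + b²) = (2a − b)² + 3b²`), hence `≥ 1` at every `(a,b) ≠ (0,0)`.
[cite: Hassett2000, Thm. 1.0.1] -/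
theorem eight_le_disc_line {a b : ℤ} (h : a ≠ 0 ∨ b ≠ 0) : 8 ≤ 8 * a ^ 2 - 8 * a * b + 8 * b ^ 2 := by
  have key : 0 < a ^ 2 - a * b + b ^ 2 := by
    rcases h with ha | hb
    · have ha2 : 1 ≤ a ^ 2 := by
        rcases Int.ne_iff_lt_or_gt.mp ha with h | h <;> nlinarith
      nlinarith [sq_nonneg (a - 2 * b)]
    · have hb2 : 1 ≤ b ^ 2 := by
        rcases Int.ne_iff_lt_or_gt.mp hb with h | h <;> nlinarith
      nlinarith [sq_nonneg (b - 2 * a)]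
  have k1 : 0 + 1 ≤ a ^ 2 - a * b + b ^ 2 := Int.add_one_le_iff.mpr key
  linarith

/-- Hassett's numerical condition "`d > 6` and `d ≡ 0, 2 (mod 6)`" [cite: Hassett2000, Thm. 1.0.1] is met by
`disc ⟨h², aΠ₁ + bΠ₂⟩` for every `(a, b) ≠ (0, 0)` when the planes meet along a line
(here already `(1,0)` qualifies: `𝒞₈`). -/
theorem hassettCondition_disc_line {a b : ℤ} (h : a ≠ 0 ∨ b ≠ 0) :
    6 < (pencilGram (-1) a b).det ∧
      ((pencilGram (-1) a b).det % 6 = 0 ∨ (pencilGram (-1) a b).det % 6 = 2) := by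
  rw [disc_line]
  exact ⟨by linarith [eight_le_disc_line h], disc_line_mod_six a b⟩

end Literature.AlgebraicGeometry.Hassett2000
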